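import Mathlib

/-!
# SoloInformedFriableInvariance — friable sieve data cannot see the rough cofactor

Solo unit `solo-Parity-informed` (ideation tier, informed mode), session 129; `PLAN.md` §94,
CLAIMS C204 (the kernel `[K]` half of the session-128 parity band C203 / `paper.md` Remark 20.29 (ix)).

Write a value `n = a · b` with `a` `y`-friable (`a ∈ Nat.smoothNumbers y`: every prime factor `< y`)
and `b` `y`-rough (every prime factor `≥ y`).  Then

* `smooth_dvd_mul_rough_iff` — for every `y`-friable modulus `d`, `d ∣ a · b ↔ d ∣ a`: the whole
  friable sieve data `A_d = #{k : d ∣ n_k}` of a sequence `n_k = a_k b_k` depends on the friable parts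
  `a_k` only (`card_filter_dvd_eq_of_rough`, `card_filter_dvd_congr_of_rough`);
* `card_divisors_smooth_mul_rough` — `τ(a b) = τ(a) τ(b)`, so the divisor sum `∑_k τ(n_k)` DOES see
  `τ(b_k)`: one rough prime gives `2 τ(a)` (`card_divisors_smooth_mul_prime`), two distinct rough
  primes give `4 τ(a)` (`card_divisors_smooth_mul_two_primes`);
* `modelA_sieve_data_eq` / `modelA_divisor_sum_eq` — the Bertrand-substitution "model A" of C203 in
  the abstract: replacing, for each `k` in a set `s`, a rough cofactor `p₁ p₂` (two distinct primes
  `≥ y`) by a single prime `p' ≥ y` leaves EVERY friable count `#{k ∈ s : d ∣ n_k}` unchanged and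
  exactly HALVES `∑_{k ∈ s} τ(n_k)`.

Informal reading (SHARPEST-STATEMENT §4 row 4, session-128 clause): any argument for
`∑_{k ≤ x} τ(f(k)) ∼ c · A_f x log x` that uses only the distribution of `f(k)` in residue classes to
`x`-friable moduli (plus sizes) cannot distinguish the true sequence from its model-A substitute on
the `N₂`-part, hence cannot determine `c`; this file is the exact combinatorial core of that remark.
All statements are elementary (coprimality of friable and rough numbers); no literature input.
-/

namespace Summit.Parity.BatemanHorn.Theorems

open Finset

/-- A `y`-friable number and a `y`-rough number are coprime. -/
theorem coprime_of_smooth_of_rough {y d b : ℕ} (hd : d ∈ Nat.smoothNumbers y)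
    (hb : ∀ p, p.Prime → p ∣ b → y ≤ p) : d.Coprime b := by
  refine Nat.coprime_of_dvd fun p hp hpd hpb => ?_
  have h1 : p < y := (Nat.mem_smoothNumbers'.mp hd) p hp hpd
  have h2 : y ≤ p := hb p hp hpb
  omega

/-- Friable moduli do not see a rough cofactor: `d ∣ a * b ↔ d ∣ a`. -/
theorem smooth_dvd_mul_rough_iff {y d a b : ℕ} (hd : d ∈ Nat.smoothNumbers y)
    (hb : ∀ p, p.Prime → p ∣ b → y ≤ p) : d ∣ a * b ↔ d ∣ a :=
  (coprime_of_smooth_of_rough hd hb).dvd_mul_right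

/-- The friable sieve count `#{k ∈ s : d ∣ a_k b_k}` equals `#{k ∈ s : d ∣ a_k}`. -/
theorem card_filter_dvd_eq_of_rough {ι : Type*} (s : Finset ι) (a b : ι → ℕ) {y d : ℕ}
    (hd : d ∈ Nat.smoothNumbers y) (hb : ∀ k ∈ s, ∀ p, p.Prime → p ∣ b k → y ≤ p) :
    (s.filter fun k => d ∣ a k * b k).card = (s.filter fun k => d ∣ a k).card := by
  congr 1
  exact Finset.filter_congr fun k hk => smooth_dvd_mul_rough_iff hd (hb k hk)

/-- Two sequences with the same friable parts and (possibly different) rough cofactors have identical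
friable sieve data. -/
theorem card_filter_dvd_congr_of_rough {ι : Type*} (s : Finset ι) (a b b' : ι → ℕ) {y d : ℕ}
    (hd : d ∈ Nat.smoothNumbers y) (hb : ∀ k ∈ s, ∀ p, p.Prime → p ∣ b k → y ≤ p)
    (hb' : ∀ k ∈ s, ∀ p, p.Prime → p ∣ b' k → y ≤ p) :
    (s.filter fun k => d ∣ a k * b k).card = (s.filter fun k => d ∣ a k * b' k).card := by
  rw [card_filter_dvd_eq_of_rough s a b hd hb, card_filter_dvd_eq_of_rough s a b' hd hb']

/-- The divisor function does see the rough cofactor: `τ(a b) = τ(a) τ(b)`. -/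
theorem card_divisors_smooth_mul_rough {y a b : ℕ} (ha : a ∈ Nat.smoothNumbers y)
    (hb : ∀ p, p.Prime → p ∣ b → y ≤ p) :
    (a * b).divisors.card = a.divisors.card * b.divisors.card :=
  Nat.Coprime.card_divisors_mul (coprime_of_smooth_of_rough ha hb)

/-- One rough prime: `τ(a p) = 2 τ(a)`. -/
theorem card_divisors_smooth_mul_prime {y a p : ℕ} (ha : a ∈ Nat.smoothNumbers y) (hp : p.Prime)
    (hyp : y ≤ p) : (a * p).divisors.card = 2 * a.divisors.card := by
  have hb : ∀ q, q.Prime → q ∣ p → y ≤ q := fun q hq hqp => by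
    rwa [(Nat.prime_dvd_prime_iff_eq hq hp).mp hqp]
  rw [card_divisors_smooth_mul_rough ha hb, Nat.Prime.divisors hp, Finset.card_pair hp.one_lt.ne,
    mul_comm]

/-- Two distinct rough primes: `τ(a p₁ p₂) = 4 τ(a)`. -/
theorem card_divisors_smooth_mul_two_primes {y a p₁ p₂ : ℕ} (ha : a ∈ Nat.smoothNumbers y)
    (hp₁ : p₁.Prime) (hp₂ : p₂.Prime) (hne : p₁ ≠ p₂) (hy₁ : y ≤ p₁) (hy₂ : y ≤ p₂) :
    (a * (p₁ * p₂)).divisors.card = 4 * a.divisors.card := by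
  have hb : ∀ q, q.Prime → q ∣ p₁ * p₂ → y ≤ q := fun q hq hqp => by
    rcases (Nat.Prime.dvd_mul hq).mp hqp with h | h
    · rwa [(Nat.prime_dvd_prime_iff_eq hq hp₁).mp h]
    · rwa [(Nat.prime_dvd_prime_iff_eq hq hp₂).mp h]
  have hcop : p₁.Coprime p₂ := (Nat.coprime_primes hp₁ hp₂).mpr hne
  rw [card_divisors_smooth_mul_rough ha hb, Nat.Coprime.card_divisors_mul hcop, Nat.Prime.divisors hp₁,
    Nat.Prime.divisors hp₂, Finset.card_pair hp₁.one_lt.ne, Finset.card_pair hp₂.one_lt.ne]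
  ring

/-- **Model A, sieve side.**  On a set `s` of indices write `n_k = a_k p₁(k) p₂(k)` (friable part times
two distinct rough primes) and the substitute `n'_k = a_k p'(k)` (one rough prime).  Every friable
count agrees: `#{k ∈ s : d ∣ n_k} = #{k ∈ s : d ∣ n'_k}` for all `d ∈ Nat.smoothNumbers y`. -/
theorem modelA_sieve_data_eq {ι : Type*} (s : Finset ι) (a p₁ p₂ p' : ι → ℕ) {y : ℕ}
    (hp₁ : ∀ k ∈ s, (p₁ k).Prime ∧ y ≤ p₁ k) (hp₂ : ∀ k ∈ s, (p₂ k).Prime ∧ y ≤ p₂ k)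
    (hp' : ∀ k ∈ s, (p' k).Prime ∧ y ≤ p' k) {d : ℕ} (hd : d ∈ Nat.smoothNumbers y) :
    (s.filter fun k => d ∣ a k * (p₁ k * p₂ k)).card = (s.filter fun k => d ∣ a k * p' k).card := by
  refine card_filter_dvd_congr_of_rough s a (fun k => p₁ k * p₂ k) p' hd ?_ ?_
  · intro k hk q hq hqp
    rcases (Nat.Prime.dvd_mul hq).mp hqp with h | h
    · rw [(Nat.prime_dvd_prime_iff_eq hq (hp₁ k hk).1).mp h]; exact (hp₁ k hk).2
    · rw [(Nat.prime_dvd_prime_iff_eq hq (hp₂ k hk).1).mp h]; exact (hp₂ k hk).2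
  · intro k hk q hq hqp
    rw [(Nat.prime_dvd_prime_iff_eq hq (hp' k hk).1).mp hqp]; exact (hp' k hk).2

/-- **Model A, divisor side.**  With the same data (and `a_k` friable), the divisor sum is exactly
halved by the substitution: `∑_{k ∈ s} τ(n_k) = 2 ∑_{k ∈ s} τ(n'_k)` (`= 4 ∑ τ(a_k)`). -/
theorem modelA_divisor_sum_eq {ι : Type*} (s : Finset ι) (a p₁ p₂ p' : ι → ℕ) {y : ℕ}
    (ha : ∀ k ∈ s, a k ∈ Nat.smoothNumbers y)
    (hp₁ : ∀ k ∈ s, (p₁ k).Prime ∧ y ≤ p₁ k) (hp₂ : ∀ k ∈ s, (p₂ k).Prime ∧ y ≤ p₂ k)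
    (hne : ∀ k ∈ s, p₁ k ≠ p₂ k) (hp' : ∀ k ∈ s, (p' k).Prime ∧ y ≤ p' k) :
    ∑ k ∈ s, (a k * (p₁ k * p₂ k)).divisors.card = 2 * ∑ k ∈ s, (a k * p' k).divisors.card ∧
      ∑ k ∈ s, (a k * p' k).divisors.card = 2 * ∑ k ∈ s, (a k).divisors.card := by
  have h1 : ∑ k ∈ s, (a k * (p₁ k * p₂ k)).divisors.card = ∑ k ∈ s, 4 * (a k).divisors.card :=
    Finset.sum_congr rfl fun k hk => card_divisors_smooth_mul_two_primes (ha k hk) (hp₁ k hk).1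
      (hp₂ k hk).1 (hne k hk) (hp₁ k hk).2 (hp₂ k hk).2
  have h2 : ∑ k ∈ s, (a k * p' k).divisors.card = ∑ k ∈ s, 2 * (a k).divisors.card :=
    Finset.sum_congr rfl fun k hk => card_divisors_smooth_mul_prime (ha k hk) (hp' k hk).1 (hp' k hk).2
  refine ⟨?_, ?_⟩
  · rw [h1, h2, ← Finset.mul_sum, ← Finset.mul_sum]; ring
  · rw [h2, ← Finset.mul_sum]

end Summit.Parity.BatemanHorn.Theorems
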